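import Literature.Geometry.Kaehler.ComplexTorusEllipticCurveCMIdealTorsion
import Literature.Geometry.Kaehler.ComplexTorusVerySimpleTorsion
import Mathlib.RingTheory.Finiteness.Nakayama
import Mathlib.RingTheory.Ideal.Norm.AbsNorm
import Mathlib.NumberTheory.NumberField.Basic
import HarnessLib

/-!
# The kernel of `End(X,i) → End(X_𝔞)` is `𝔞·End(X,i)`, and a scalar action on `X_λ` forces
# `End_K(X,i) = 𝒪` (Zarhin 2009, (3), (4), Lemma 3.8; Zarhin 2018, §3.6, Lemma 3.12, Cor. 3.13 — at torus level)

Layer `Literature/Geometry/Kaehler`, namespace `Literature.Geometry.Kaehler.ComplexTorus`; lane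
`lit-hodgefound` (Track 2 foundations library), seat p11, generation 20, row g20-#4. THEOREMS ONLY (no
definition, no named fact; D-0026 net debt 0). Sequel BY NAME of `ComplexTorusEllipticCurveCMIdealTorsion` §1
(p19: `idealTorsion Φ ρ 𝔞 = X[𝔞] = {t | ρ(a)t = 0 ∀ a ∈ 𝔞}` for ANY torus and ring action `ρ : R →+* M_ι(ℤ)`),
`ComplexTorusVerySimpleTorsion` §1 (this seat, gen 8: `ρ_r(A)` acts on `X_n ≃ (ℤ/n)^ι` as `A mod n`,
`divisionPointsEquiv_mapMatrix`) and `ComplexTorusTateModuleHom` (`mem_endRingInt_of_smul_mem`: `End(X)` is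
saturated in `M_ι(ℤ)`).

## Sources, verbatim

Yu. G. Zarhin, *Endomorphisms of superelliptic jacobians*, Math. Z. 261 (2009) 691–707, §3 (held
`paper:arxiv-math_0605028`, p0007–p0008) [Zarhin2009EndomorphismsSuperellipticJacobians]: "We write `End(X,i)`
for the centralizer of `i(𝒪)` in `End(X)` and `End_K(X,i)` for the centralizer of `i(𝒪)` in `End_K(X)`.
Obviously, `End(X,i)` is a pure subgroup in `End(X)` and `End_K(X,i) = End(X,i) ∩ End_K(X)` is a pure subgroup
in `End(X,i)` […] `X_𝔞 := {x ∈ X(K_a) ∣ i(e)x = 0 ∀ e ∈ 𝔞}`. […] Obviously, every endomorphism from `End(X,i)`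
leaves invariant the subgroup `X_𝔞 ⊂ X(K_a)` and induces an endomorphism of the `𝒪/𝔞`-module `X_𝔞`. This
gives rise to a natural homomorphism `End(X,i) → End_{𝒪/𝔞}(X_𝔞)`, whose kernel contains `𝔞·End(X,i)`. We
claim that actually, the kernel coincides with `𝔞·End(X,i)`, i. e. there is an embedding
`End(X,i) ⊗_𝒪 𝒪/𝔞 ↪ End_{𝒪/𝔞} X_𝔞 (3)`. In order to prove it, let us denote by `n` the order of `𝒪/𝔞`. We
have `n𝒪 ⊂ 𝔞`. Since `𝒪` is a Dedekind ring, there exists a non-zero ideal `𝔞′` in `𝒪` such that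
`𝔞′𝔞 = n𝒪`. Clearly `𝔞′X_n ⊂ X_𝔞`. It follows that if `u ∈ End(X,𝒪)` kills `X_𝔞` then `hu = uh` kills `X_n`
for each `h ∈ 𝔞′`. This implies that `𝔞′u ⊂ nEnd(X) ∩ End(X,𝒪) = nEnd(X,𝒪) = n(𝔟₁ ⊕ ⋯ ⊕ 𝔟_t)` […] we have
`u ∈ 𝔞𝔟₁ ⊕ ⋯ ⊕ 𝔞𝔟_t = 𝔞·End(X,𝒪)` and we are done. […] (3) gives us the embedding
`End(X,i) ⊗_𝒪 k(λ) ↪ End_{k(λ)}(X_λ) (4)`. […] It is also clear that the image of `End_K(X,i) ⊗_𝒪 k(λ)`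
lies in the centralizer `End_{G̃_{λ,X,K}}(X_λ)` […]. **Lemma 3.8.** Suppose that `i(𝒪) ⊂ End_K(X)`. If
`λ` is a maximal ideal in `𝒪` such that `ℓ ≠ char(K)` and `End_{G̃_{λ,X,K}}(X_λ) = k(λ)` then
`End_K(X,i) = 𝒪`. *Proof.* Clearly, `End_K(X,i)` is a finitely generated torsion free `𝒪`-module and
therefore is isomorphic to a direct sum of say, `r` (non-zero) ideals in `𝒪`. Clearly, `r = 1` and therefore
`𝒪 ⊂ End_K(X,i) ⊂ E`. Since `𝒪` is the maximal order in `E`, we conclude that `End_K(X,i) = 𝒪`."  Also §2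
Remark 2.1 (p0005): "`u ∈ End(X)` kills `X_ℓ` (i.e. `u(X_ℓ) = 0`) if and only if `u ∈ ℓ·End(X)`."

Yu. G. Zarhin, *Endomorphism algebras of abelian varieties with special reference to superelliptic jacobians*
(2018; held `paper:arxiv-1706.00110`, p0007–p0009) [Zarhin2018SuperellipticJacobians], §3.6 (the same
`X_λ`, `End_K(X,i)` an `𝒪`-algebra), §3.7 **Lemma 3.12** "([ZarhinMZ2]) If the centralizer
`End_{G̃_{λ,X,K}}(X_λ) = k(λ)` then `End_K(X,i) = i(𝒪)`" and **Corollary 3.13** "If the centralizer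
`End_{G̃_{λ,X,K}}(X_λ) = k(λ)` then `End_K^0(X,i) = i(E)`."

## Statement formalised, and the recorded deviation

The carrier is the tree's complex torus `X = E/Φ(ℤ^ι)` (`ComplexTorus Φ`) with its rational representation
on integer matrices (`mapMatrix Φ Φ A`, `End(X) = endRingInt Φ`), a ring `R` (`𝒪`) acting by
`ρ : R →+* M_ι(ℤ)`, and `X_𝔞 = idealTorsion Φ ρ 𝔞`. The rings of the print are captured by a subring
`S ⊆ M_ι(ℤ)` with `ρ(R) ⊆ S`, `S ⊆ C(ρR)` and `S` SATURATED (`m·w ∈ S, m ≠ 0 ⇒ w ∈ S` — "pure subgroup"):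
`End(X,i) = endRingInt Φ ⊓ Subring.centralizer (range ρ)` satisfies them for a holomorphic action
(§4, `map_mem_endRingInt_inf_centralizer`, `map_mul_eq_mul_map_of_mem_centralizer`,
`mem_endRingInt_inf_centralizer_of_smul_mem`), and so do its invariants `S^G` under any family of ring
endomorphisms fixing `ρ(R)` (`map_mem_inf_eqLocus_and_saturated`) — the print's `End_K(X,i) = End(X,i)^{Gal(K)}`.

* §1 `forall_divisionPoints_mapMatrix_eq_zero_iff`: `u` kills `X_n` iff `u ∈ nM_ι(ℤ)` (Remark 2.1).
* §2 **(3)** `forall_idealTorsion_mapMatrix_eq_zero_iff` (`𝔞 ∣ n𝒪`, any commutative `R`),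
  `…_of_natCast_mem` (Dedekind `R`, `n ∈ 𝔞`), `…_endRingInt` (for `End(X,i)` itself): for `u ∈ S`, `u` kills
  `X_𝔞` iff `u ∈ 𝔞S := AddSubgroup.closure {ρ(a)s | a ∈ 𝔞, s ∈ S}`. DEVIATION in the last step of the printed
  proof: instead of "`End(X,𝒪) ≅ 𝔟₁ ⊕ ⋯ ⊕ 𝔟_t`" (structure of torsion-free modules over a Dedekind ring) we use
  `n = Σ aₖhₖ ∈ 𝔞𝔞′`, `n·u = Σ ρ(aₖ)(ρ(hₖ)u) ∈ n·𝔞S` and torsion-freeness of `M_ι(ℤ)` — same hypotheses, same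
  statement.
* §3 **Lemma 3.8 / Lemma 3.12 / Cor. 3.13**, with the Galois hypothesis "`End_{G̃}(X_λ) = k(λ)`" entering
  through its printed consequence "the image of `End_K(X,i) ⊗ k(λ)` lies in `k(λ)`", i.e.
  `hscal : ∀ u ∈ S, ∃ a, (u − ρ a)` kills `X_𝔞` (a Galois action on torsion points needs a model of `X` over
  `K`, which the analytic carrier does not have — the same treatment as `ComplexTorusVerySimpleTorsion`,
  `TODO(printed setting)`): `exists_sub_map_mem_closure_of_forall_idealTorsion` (`S = ρ(R) + 𝔞S`, i.e.
  "`dim_{k(λ)} ≤ 1`" pulled back by (4)), `exists_sub_one_mem_and_forall_mul_eq_map` (Cor. 3.13: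
  `∃ r ≡ 1 (mod 𝔞), ρ(r)S ⊆ ρ(R)`, so `S ⊗ ℚ = ρ(R) ⊗ ℚ`; Nakayama replaces "`r = 1`"),
  `exists_eq_map_of_forall_idealTorsion` and `…_invariants` (Lemma 3.8 / 3.12: for `R = 𝒪_K` the maximal
  order, `ρ` injective, `𝔞 ≠ 0` proper — in print `𝔞 = λ` maximal — `S = ρ(𝒪_K)`, via Cayley–Hamilton and
  integral closedness: "Since `𝒪` is the maximal order in `E`").

## References

* [Zarhin2009EndomorphismsSuperellipticJacobians] Yu. G. Zarhin, Endomorphisms of superelliptic jacobians,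
  Math. Z. 261 (2009), §2 Rem. 2.1, §3 (3), (4), Lemma 3.8 (arXiv math/0605028, pp. 5, 7–8).
* [Zarhin2018SuperellipticJacobians] Yu. G. Zarhin, Endomorphism algebras of abelian varieties with special
  reference to superelliptic jacobians, arXiv:1706.00110, §2.3, §3.6, Lemma 3.12, Cor. 3.13 (pp. 5, 7–9).
* [Lange2023AbelianVarietiesComplex] H. Lange, Abelian Varieties over the Complex Numbers (2023), §1.1.2
  Prop. 1.1.14 (`X_n ≃ (ℤ/nℤ)^{2g}`).
-/

noncomputable section

open Module Function
open scoped Matrix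

namespace Literature.Geometry.Kaehler.ComplexTorus

variable {ι : Type*} [Fintype ι] [DecidableEq ι] {E : Type*} [NormedAddCommGroup E] [NormedSpace ℂ E]
  (Φ : (ι → ℝ) ≃L[ℝ] E)

/-! ### §0 Plumbing: additivity of `mapMatrix` in the matrix -/

omit [DecidableEq ι] in
/-- `ρ_r` is additive in the matrix: `(A + B)·t = A·t + B·t`. [folklore] -/
private theorem mapMatrix_add_mat (A B : Matrix ι ι ℤ) (t : ComplexTorus Φ) :
    mapMatrix Φ Φ (A + B) t = mapMatrix Φ Φ A t + mapMatrix Φ Φ B t := by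
  funext i
  simp only [mapMatrix, Matrix.add_apply, add_smul, Finset.sum_add_distrib]
  rfl

omit [DecidableEq ι] in
/-- `0·t = 0`. [folklore] -/
private theorem mapMatrix_zero_mat (t : ComplexTorus Φ) : mapMatrix Φ Φ (0 : Matrix ι ι ℤ) t = 0 := by
  funext i
  simp only [mapMatrix, Matrix.zero_apply, zero_smul, Finset.sum_const_zero]
  rfl

omit [DecidableEq ι] in
/-- `A·0 = 0`. [folklore] -/
private theorem mapMatrix_zero_pt (A : Matrix ι ι ℤ) : mapMatrix Φ Φ A (0 : ComplexTorus Φ) = 0 :=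
  (mapMatrixHom Φ Φ A).map_zero

/-! ### §1 An endomorphism kills `X_n` iff it is divisible by `n` -/

/-- **`u` kills the `n`-division points `X_n` iff `u ∈ n·M_ι(ℤ)`** ("`u ∈ End(X)` kills `X_ℓ` (i.e.
`u(X_ℓ) = 0`) if and only if `u ∈ ℓ·End(X)`"): under Lange's `X_n ≃ (ℤ/n)^ι` (`divisionPointsEquiv`) the
endomorphism `ρ_r(A)` acts as `A mod n` (`divisionPointsEquiv_mapMatrix`), which vanishes iff `n ∣ A`.
[cite: Zarhin2009EndomorphismsSuperellipticJacobians, §2 Remark 2.1 (arXiv p0005: "`u ∈ End(X)` kills `X_ℓ` … if and only if `u ∈ ℓ·End(X)`")]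
[cite: Lange2023AbelianVarietiesComplex, §1.1.2 Prop. 1.1.14] -/
theorem forall_divisionPoints_mapMatrix_eq_zero_iff {n : ℤ} (hn : n ≠ 0) (A : Matrix ι ι ℤ) :
    (∀ t ∈ (mapMatrixHom Φ Φ (n • (1 : Matrix ι ι ℤ))).ker, mapMatrix Φ Φ A t = 0) ↔
      ∃ B : Matrix ι ι ℤ, A = n • B := by
  constructor
  · intro h
    have hv : ∀ v : ι → ZMod n.natAbs, A.map (Int.cast : ℤ → ZMod n.natAbs) *ᵥ v = 0 := by
      intro v
      obtain ⟨t, rfl⟩ := (divisionPointsEquiv Φ hn).surjective v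
      rw [← divisionPointsEquiv_mapMatrix Φ hn A t]
      have h0 : (⟨mapMatrix Φ Φ A t, mem_ker_smul_one_mapMatrix Φ A t.2⟩ :
          (mapMatrixHom Φ Φ (n • (1 : Matrix ι ι ℤ))).ker) = 0 := Subtype.ext (h t t.2)
      rw [h0, map_zero]
    have hdvd : ∀ i j, n ∣ A i j := fun i j ↦ by
      have hij := congrFun (hv (Pi.single j 1)) i
      simp only [Matrix.mulVec, dotProduct, Matrix.map_apply, Pi.single_apply, mul_ite, mul_one,
        mul_zero, Finset.sum_ite_eq', Finset.mem_univ, if_true, Pi.zero_apply] at hij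
      exact Int.natAbs_dvd.1 ((ZMod.intCast_zmod_eq_zero_iff_dvd (A i j) n.natAbs).1 hij)
    choose q hq using hdvd
    refine ⟨Matrix.of q, ?_⟩
    ext i j
    simp [hq i j]
  · rintro ⟨B, rfl⟩ t ht
    rw [mem_ker_mapMatrixHom_smul_one_iff] at ht
    rw [mapMatrix_smul, ← mapMatrixHom_apply, ← map_zsmul, ht, map_zero]

/-! ### §2 The kernel of `End(X,i) → End(X_𝔞)` is `𝔞·End(X,i)` (Zarhin 2009 (3)) -/

variable {R : Type*} [CommRing R] (ρ : R →+* Matrix ι ι ℤ)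

/-- An endomorphism commuting with the `𝒪`-action preserves `X_𝔞` ("every endomorphism from `End(X,i)`
leaves invariant the subgroup `X_𝔞`"). [cite: Zarhin2009EndomorphismsSuperellipticJacobians, §3 before (3) (arXiv p0008)] -/
theorem mapMatrix_mem_idealTorsion_of_forall_commute {s : Matrix ι ι ℤ} (hs : ∀ a, ρ a * s = s * ρ a)
    {𝔞 : Ideal R} {t : ComplexTorus Φ} (ht : t ∈ idealTorsion Φ ρ 𝔞) :
    mapMatrix Φ Φ s t ∈ idealTorsion Φ ρ 𝔞 := by
  rw [mem_idealTorsion_iff] at ht ⊢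
  intro a ha
  rw [mapMatrix_mapMatrix, hs a, ← mapMatrix_mapMatrix (Φ' := Φ), ht a ha, mapMatrix_zero_pt]

/-- `ρ(𝒪 n) = n·1` acts as multiplication by `n`, so it kills `X_n`. [folklore] -/
private theorem mapMatrix_natCast_eq_zero_of_mem_ker {n : ℕ} {t : ComplexTorus Φ}
    (ht : t ∈ (mapMatrixHom Φ Φ ((n : ℤ) • (1 : Matrix ι ι ℤ))).ker) : mapMatrix Φ Φ (ρ n) t = 0 := by
  rw [map_natCast, ← Int.cast_natCast, ← zsmul_one]
  exact ht

/-- **`𝔞′X_n ⊂ X_𝔞`** for `𝔞′𝔞 = n𝒪`: `ρ(h)` maps the `n`-division points into the `𝔞`-torsion for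
`h ∈ 𝔞′`. [cite: Zarhin2009EndomorphismsSuperellipticJacobians, §3 proof of (3) (arXiv p0008: "Clearly `𝔞′X_n ⊂ X_𝔞`")] -/
theorem mapMatrix_mem_idealTorsion_of_mul_eq_span {𝔞 𝔞' : Ideal R} {n : ℕ}
    (h𝔞 : Ideal.span {(n : R)} = 𝔞 * 𝔞') {h : R} (hh : h ∈ 𝔞') {t : ComplexTorus Φ}
    (ht : t ∈ (mapMatrixHom Φ Φ ((n : ℤ) • (1 : Matrix ι ι ℤ))).ker) :
    mapMatrix Φ Φ (ρ h) t ∈ idealTorsion Φ ρ 𝔞 := by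
  rw [mem_idealTorsion_iff]
  intro a ha
  have hah : a * h ∈ Ideal.span {(n : R)} := h𝔞 ▸ Ideal.mul_mem_mul ha hh
  obtain ⟨c, hc⟩ := Ideal.mem_span_singleton'.1 hah
  rw [mapMatrix_mapMatrix, ← map_mul, ← hc, map_mul, ← mapMatrix_mapMatrix (Φ' := Φ),
    mapMatrix_natCast_eq_zero_of_mem_ker Φ ρ ht, mapMatrix_zero_pt]

/-- Elements of `𝔞·S = Σ ρ(𝔞)S` kill `X_𝔞` (the easy inclusion "whose kernel contains `𝔞·End(X,i)`").
[cite: Zarhin2009EndomorphismsSuperellipticJacobians, §3 before (3) (arXiv p0008)] -/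
theorem mapMatrix_eq_zero_of_mem_closure (S : Set (Matrix ι ι ℤ)) (hSC : ∀ s ∈ S, ∀ a, ρ a * s = s * ρ a)
    {𝔞 : Ideal R} {u : Matrix ι ι ℤ}
    (hu : u ∈ AddSubgroup.closure {v | ∃ a ∈ 𝔞, ∃ s ∈ S, ρ a * s = v})
    {t : ComplexTorus Φ} (ht : t ∈ idealTorsion Φ ρ 𝔞) : mapMatrix Φ Φ u t = 0 := by
  induction hu using AddSubgroup.closure_induction with
  | mem v hv =>
    obtain ⟨a, ha, s, hs, rfl⟩ := hv
    rw [← mapMatrix_mapMatrix (Φ' := Φ)]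
    exact (mem_idealTorsion_iff Φ ρ).1 (mapMatrix_mem_idealTorsion_of_forall_commute Φ ρ (hSC s hs) ht) a ha
  | zero => exact mapMatrix_zero_mat Φ t
  | add v w _ _ hv hw => rw [mapMatrix_add_mat, hv, hw, add_zero]
  | neg v _ hv => rw [mapMatrix_neg, hv, neg_zero]

/-- **Zarhin 2009, (3) — the kernel of `End(X,i) → End_{𝒪/𝔞}(X_𝔞)` is exactly `𝔞·End(X,i)`: "there is an
embedding `End(X,i) ⊗_𝒪 𝒪/𝔞 ↪ End_{𝒪/𝔞} X_𝔞`"**, at torus level and for any subring `S` of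
`ρ(𝒪)`-commuting integer matrices containing `ρ(𝒪)` which is SATURATED in `M_ι(ℤ)` (`m·w ∈ S ⇒ w ∈ S`; the
print's `End(X,i)`, "a pure subgroup in `End(X)`", or its Galois invariants `End_K(X,i)`), and any ideal
`𝔞 ∣ n𝒪`, `n ≥ 1` (in a Dedekind `𝒪`: any `𝔞 ∋ n`). The printed proof: with `𝔞′𝔞 = n𝒪` and `𝔞′X_n ⊂ X_𝔞`,
"if `u` kills `X_𝔞` then `hu = uh` kills `X_n` for each `h ∈ 𝔞′`", so `𝔞′u ⊂ nM_ι(ℤ) ∩ S = nS` (saturation);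
the last step "`u ∈ 𝔞𝔟₁ ⊕ ⋯ ⊕ 𝔞𝔟_t = 𝔞·End(X,𝒪)`" (structure of torsion-free `𝒪`-modules) is replaced by the
elementary `n = Σ aₖhₖ` (`aₖ ∈ 𝔞`, `hₖ ∈ 𝔞′`): `n·u = Σ ρ(aₖ)(ρ(hₖ)u) ∈ n·𝔞S`, and `M_ι(ℤ)` is torsion-free.
[cite: Zarhin2009EndomorphismsSuperellipticJacobians, §3 (3) with proof (arXiv p0008)]
[cite: Zarhin2018SuperellipticJacobians, §3.6 (arXiv p0007)] -/
theorem forall_idealTorsion_mapMatrix_eq_zero_iff (S : Subring (Matrix ι ι ℤ)) (hρS : ∀ a, ρ a ∈ S)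
    (hSC : ∀ s ∈ S, ∀ a, ρ a * s = s * ρ a) (hSsat : ∀ (m : ℤ), m ≠ 0 → ∀ w, m • w ∈ S → w ∈ S)
    {𝔞 : Ideal R} {n : ℕ} (hn : n ≠ 0) (h𝔞 : 𝔞 ∣ Ideal.span {(n : R)})
    {u : Matrix ι ι ℤ} (hu : u ∈ S) :
    (∀ t ∈ idealTorsion Φ ρ 𝔞, mapMatrix Φ Φ u t = 0) ↔
      u ∈ AddSubgroup.closure {v | ∃ a ∈ 𝔞, ∃ s ∈ S, ρ a * s = v} := by
  refine ⟨fun hkill ↦ ?_, fun hmem t ht ↦ mapMatrix_eq_zero_of_mem_closure Φ ρ S hSC hmem ht⟩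
  obtain ⟨𝔞', h𝔞'⟩ := h𝔞
  have hn' : (n : ℤ) ≠ 0 := by exact_mod_cast hn
  -- step 1: `𝔞′u ⊂ nS`
  have step1 : ∀ h ∈ 𝔞', ∃ w ∈ S, ρ h * u = (n : ℤ) • w := by
    intro h hh
    have hk : ∀ t ∈ (mapMatrixHom Φ Φ ((n : ℤ) • (1 : Matrix ι ι ℤ))).ker,
        mapMatrix Φ Φ (ρ h * u) t = 0 := fun t ht ↦ by
      rw [hSC u hu h, ← mapMatrix_mapMatrix (Φ' := Φ)]
      exact hkill _ (mapMatrix_mem_idealTorsion_of_mul_eq_span Φ ρ h𝔞' hh ht)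
    obtain ⟨w, hw⟩ := (forall_divisionPoints_mapMatrix_eq_zero_iff Φ hn' _).1 hk
    exact ⟨w, hSsat n hn' w (hw ▸ S.mul_mem (hρS h) hu), hw⟩
  -- step 2: `ρ(x) u ∈ n·𝔞S` for every `x ∈ 𝔞𝔞′ = n𝒪`
  have step2 : ∀ x ∈ 𝔞 * 𝔞', ∃ v ∈ AddSubgroup.closure {v | ∃ a ∈ 𝔞, ∃ s ∈ S, ρ a * s = v},
      ρ x * u = (n : ℤ) • v := by
    intro x hx
    refine Submodule.mul_induction_on hx (fun a ha h hh ↦ ?_) ?_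
    · obtain ⟨w, hwS, hw⟩ := step1 h hh
      refine ⟨ρ a * w, AddSubgroup.subset_closure ⟨a, ha, w, hwS, rfl⟩, ?_⟩
      rw [map_mul, mul_assoc, hw, mul_smul_comm]
    · rintro x y ⟨v, hv, hx⟩ ⟨v', hv', hy⟩
      exact ⟨v + v', add_mem hv hv', by rw [map_add, add_mul, hx, hy, smul_add]⟩
  have hnmem : (n : R) ∈ 𝔞 * 𝔞' := h𝔞' ▸ Ideal.mem_span_singleton_self _
  obtain ⟨v, hv, hnu⟩ := step2 _ hnmem
  rw [map_natCast, ← nsmul_eq_mul, ← natCast_zsmul] at hnu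
  have huv : u = v := by
    ext i j
    have hij := congrFun (congrFun hnu i) j
    simp only [Matrix.smul_apply, smul_eq_mul] at hij
    exact mul_left_cancel₀ hn' hij
  exact huv ▸ hv

/-- The same over a Dedekind domain `𝒪` for any ideal `𝔞` containing a positive integer `n` ("there exists
a non-zero ideal `𝔞′` in `𝒪` such that `𝔞′𝔞 = n𝒪`"). [cite: Zarhin2009EndomorphismsSuperellipticJacobians, §3 (3) (arXiv p0008)] -/
theorem forall_idealTorsion_mapMatrix_eq_zero_iff_of_natCast_mem [IsDedekindDomain R]
    (S : Subring (Matrix ι ι ℤ)) (hρS : ∀ a, ρ a ∈ S)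
    (hSC : ∀ s ∈ S, ∀ a, ρ a * s = s * ρ a) (hSsat : ∀ (m : ℤ), m ≠ 0 → ∀ w, m • w ∈ S → w ∈ S)
    {𝔞 : Ideal R} {n : ℕ} (hn : n ≠ 0) (hn𝔞 : (n : R) ∈ 𝔞) {u : Matrix ι ι ℤ} (hu : u ∈ S) :
    (∀ t ∈ idealTorsion Φ ρ 𝔞, mapMatrix Φ Φ u t = 0) ↔
      u ∈ AddSubgroup.closure {v | ∃ a ∈ 𝔞, ∃ s ∈ S, ρ a * s = v} :=
  forall_idealTorsion_mapMatrix_eq_zero_iff Φ ρ S hρS hSC hSsat hn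
    (Ideal.dvd_iff_le.2 ((Ideal.span_singleton_le_iff_mem _).2 hn𝔞)) hu

/-! ### §3 Scalar action on `X_λ` forces `End_K(X,i) = 𝒪` (Zarhin 2009 Lemma 3.8; 2018 Lemma 3.12, Cor. 3.13) -/

/-- **Step 1 — `dim_{k(λ)}` of the image is `≤ 1` read back in `S`: `S = ρ(𝒪) + λS`.** If every `u ∈ S`
acts on `X_λ` as a scalar `ρ(a)`, `a ∈ 𝒪` ("the image of `End_K(X,i) ⊗_𝒪 k(λ)` lies in […] `k(λ)`"), then
`u − ρ(a)` kills `X_λ`, hence lies in `λS` by (3). [cite: Zarhin2009EndomorphismsSuperellipticJacobians, §3 (4) and proof of Lemma 3.8 (arXiv p0008)]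
[cite: Zarhin2018SuperellipticJacobians, §3.7 Lemma 3.12 (arXiv p0008)] -/
theorem exists_sub_map_mem_closure_of_forall_idealTorsion (S : Subring (Matrix ι ι ℤ)) (hρS : ∀ a, ρ a ∈ S)
    (hSC : ∀ s ∈ S, ∀ a, ρ a * s = s * ρ a) (hSsat : ∀ (m : ℤ), m ≠ 0 → ∀ w, m • w ∈ S → w ∈ S)
    {𝔞 : Ideal R} {n : ℕ} (hn : n ≠ 0) (h𝔞 : 𝔞 ∣ Ideal.span {(n : R)})
    (hscal : ∀ u ∈ S, ∃ a : R, ∀ t ∈ idealTorsion Φ ρ 𝔞, mapMatrix Φ Φ (u - ρ a) t = 0)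
    {u : Matrix ι ι ℤ} (hu : u ∈ S) :
    ∃ a : R, u - ρ a ∈ AddSubgroup.closure {v | ∃ l ∈ 𝔞, ∃ s ∈ S, ρ l * s = v} := by
  obtain ⟨a, ha⟩ := hscal u hu
  exact ⟨a, (forall_idealTorsion_mapMatrix_eq_zero_iff Φ ρ S hρS hSC hSsat hn h𝔞
    (S.sub_mem hu (hρS a))).1 ha⟩

/-- **Zarhin 2018, Cor. 3.13 at torus level — `End_K^0(X,i) = i(E)`**: under the hypotheses of
`exists_sub_map_mem_closure_of_forall_idealTorsion` (every element of the saturated `ρ(𝒪)`-commuting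
subring `S ∋ ρ(𝒪)` acts on `X_𝔞` as a scalar from `𝒪`, `𝔞 ∣ n𝒪`), there is `r ≡ 1 (mod 𝔞)` in `𝒪` with
`ρ(r)·S ⊆ ρ(𝒪)` — so `S ⊗ ℚ = ρ(𝒪) ⊗ ℚ` ("`End_K^0(X,i) = i(E)`"). The print argues "`End_K(X,i)` […] is
isomorphic to a direct sum of say, `r` ideals in `𝒪`. Clearly, `r = 1`"; here: `S = ρ(𝒪)·1 + 𝔞S` and
Nakayama's lemma (Mathlib `Submodule.exists_sub_one_mem_and_smul_eq_zero_of_fg_of_le_smul`) for the finitely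
generated `𝒪`-module `S/ρ(𝒪)`. In print the scalar hypothesis is the consequence of
"`End_{G̃_{λ,X,K}}(X_λ) = k(λ)`" for the Galois image `G̃` — a Galois action on torsion requires a model over
`K`, which the analytic carrier does not have, so (as in `ComplexTorusVerySimpleTorsion`) its printed
consequence on `S = End_K(X,i)` is the hypothesis. [cite: Zarhin2018SuperellipticJacobians, §3.7 Lemma 3.12 and Cor. 3.13 (arXiv p0008–p0009)]
[cite: Zarhin2009EndomorphismsSuperellipticJacobians, §3 Lemma 3.8 (arXiv p0008)] -/
theorem exists_sub_one_mem_and_forall_mul_eq_map (S : Subring (Matrix ι ι ℤ)) (hρS : ∀ a, ρ a ∈ S)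
    (hSC : ∀ s ∈ S, ∀ a, ρ a * s = s * ρ a) (hSsat : ∀ (m : ℤ), m ≠ 0 → ∀ w, m • w ∈ S → w ∈ S)
    {𝔞 : Ideal R} {n : ℕ} (hn : n ≠ 0) (h𝔞 : 𝔞 ∣ Ideal.span {(n : R)})
    (hscal : ∀ u ∈ S, ∃ a : R, ∀ t ∈ idealTorsion Φ ρ 𝔞, mapMatrix Φ Φ (u - ρ a) t = 0) :
    ∃ r : R, r - 1 ∈ 𝔞 ∧ ∀ u ∈ S, ∃ b : R, ρ r * u = ρ b := by
  classical
  letI : Module R (Matrix ι ι ℤ) := Module.compHom (Matrix ι ι ℤ) ρ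
  have hsmul : ∀ (a : R) (v : Matrix ι ι ℤ), a • v = ρ a * v := fun _ _ ↦ rfl
  -- `S` as an `𝒪`-module, finitely generated (it is a subgroup of `M_ι(ℤ) ≅ ℤ^{ι × ι}`)
  let M : Submodule R (Matrix ι ι ℤ) :=
    { carrier := S
      add_mem' := fun ha hb ↦ S.add_mem ha hb
      zero_mem' := S.zero_mem
      smul_mem' := fun a v hv ↦ S.mul_mem (hρS a) hv }
  have hMS : ∀ v, v ∈ M ↔ v ∈ S := fun _ ↦ Iff.rfl
  have hMfg : M.FG := by
    obtain ⟨T, hT⟩ : (AddSubgroup.toIntSubmodule S.toAddSubgroup).FG := IsNoetherian.noetherian _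
    refine ⟨T, le_antisymm (Submodule.span_le.2 fun v hv ↦ ?_) fun v hv ↦ ?_⟩
    · have hvS : v ∈ AddSubgroup.toIntSubmodule S.toAddSubgroup := hT ▸ Submodule.subset_span hv
      exact hvS
    · have hv' : v ∈ Submodule.span ℤ (T : Set (Matrix ι ι ℤ)) := by rw [hT]; exact hv
      exact Submodule.span_le_restrictScalars ℤ R (T : Set (Matrix ι ι ℤ)) hv'
  let N : Submodule R (Matrix ι ι ℤ) := R ∙ (1 : Matrix ι ι ℤ)
  have hρN : ∀ a, ρ a ∈ N := fun a ↦ Submodule.mem_span_singleton.2 ⟨a, by rw [hsmul, mul_one]⟩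
  let P : Submodule R (Matrix ι ι ℤ ⧸ N) := M.map N.mkQ
  have hP : P ≤ 𝔞 • P := by
    rintro _ ⟨v, hv, rfl⟩
    obtain ⟨a, ha⟩ :=
      exists_sub_map_mem_closure_of_forall_idealTorsion Φ ρ S hρS hSC hSsat hn h𝔞 hscal ((hMS v).1 hv)
    have hsplit : N.mkQ v = N.mkQ (v - ρ a) := by
      rw [map_sub, (N.mkQ_apply (ρ a)).trans ((Submodule.Quotient.mk_eq_zero N).2 (hρN a)), sub_zero]
    rw [hsplit]
    refine AddSubgroup.closure_induction (p := fun z _ ↦ N.mkQ z ∈ 𝔞 • P) (fun z hz ↦ ?_) ?_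
      (fun z w _ _ hz hw ↦ ?_) (fun z _ hz ↦ ?_) ha
    · obtain ⟨l, hl, s, hs, rfl⟩ := hz
      rw [← hsmul, map_smul]
      exact Submodule.smul_mem_smul hl ⟨s, (hMS s).2 hs, rfl⟩
    · rw [map_zero]; exact zero_mem _
    · rw [map_add]; exact add_mem hz hw
    · rw [map_neg]; exact neg_mem hz
  obtain ⟨r, hr1, hr⟩ :=
    Submodule.exists_sub_one_mem_and_smul_eq_zero_of_fg_of_le_smul 𝔞 P (hMfg.map _) hP
  refine ⟨r, hr1, fun u hu ↦ ?_⟩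
  have h0 : r • N.mkQ u = 0 := hr _ ⟨u, (hMS u).2 hu, rfl⟩
  rw [← map_smul, Submodule.mkQ_apply, Submodule.Quotient.mk_eq_zero, Submodule.mem_span_singleton] at h0
  obtain ⟨b, hb⟩ := h0
  exact ⟨b, by rw [← hsmul, ← hb, hsmul, mul_one]⟩

/-- `ρ(r)` is left-cancellable for `r ≠ 0` in the maximal order `𝒪 = 𝒪_K`: `r′r = N(r𝒪) ∈ ℤ ∖ {0}` and
`M_ι(ℤ)` is torsion-free. [folklore] -/
private theorem eq_zero_of_map_ringOfIntegers_mul_eq_zero {K : Type*} [Field K] [NumberField K]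
    (ρ : NumberField.RingOfIntegers K →+* Matrix ι ι ℤ) {r : NumberField.RingOfIntegers K} (hr : r ≠ 0)
    {v : Matrix ι ι ℤ} (hv : ρ r * v = 0) : v = 0 := by
  have hm0 : Ideal.absNorm (Ideal.span {r}) ≠ 0 := fun h ↦
    hr (Ideal.span_singleton_eq_bot.1 (Ideal.absNorm_eq_zero_iff.1 h))
  obtain ⟨r', hr'⟩ := Ideal.mem_span_singleton'.1 (Ideal.absNorm_mem (Ideal.span {r}))
  have hmv : ((Ideal.absNorm (Ideal.span {r}) : ℕ) : ℤ) • v = 0 := by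
    have h1 : ρ (r' * r) * v = 0 := by rw [map_mul, mul_assoc, hv, mul_zero]
    rwa [hr', map_natCast, ← nsmul_eq_mul, ← natCast_zsmul] at h1
  ext i j
  have hij := congrFun (congrFun hmv i) j
  simp only [Matrix.smul_apply, smul_eq_mul, Matrix.zero_apply, mul_eq_zero] at hij
  exact hij.resolve_left (by exact_mod_cast hm0)

/-- **Zarhin 2009, Lemma 3.8 / Zarhin 2018, Lemma 3.12 at torus level — `End_K(X,i) = i(𝒪)`**: for the
MAXIMAL order `𝒪 = 𝒪_K` of a number field acting faithfully (`ρ` injective) on the complex torus `X`, a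
subring `S` of `ρ(𝒪)`-commuting integer matrices containing `ρ(𝒪)` and saturated in `M_ι(ℤ)` all of whose
elements act on `X_𝔞` (`𝔞 ≠ 0, 𝒪` — in print a maximal ideal `λ`) as scalars from `𝒪` IS `ρ(𝒪)`: by
Cor. 3.13 `ρ(r)u = ρ(b)` with `r ≢ 0`, so `b/r ∈ K` is a root of the (monic, integral) characteristic
polynomial of `u` (Cayley–Hamilton, read through the injective `ρ` with `Polynomial.scaleRoots`), hence
`b/r ∈ 𝒪` ("Since `𝒪` is the maximal order in `E`, we conclude that `End_K(X,i) = 𝒪`") and `u = ρ(b/r)`.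
[cite: Zarhin2009EndomorphismsSuperellipticJacobians, §3 Lemma 3.8 (arXiv p0008)]
[cite: Zarhin2018SuperellipticJacobians, §3.7 Lemma 3.12 (arXiv p0008)] -/
theorem exists_eq_map_of_forall_idealTorsion {K : Type*} [Field K] [NumberField K]
    (ρ : NumberField.RingOfIntegers K →+* Matrix ι ι ℤ) (hρ : Injective ρ)
    (S : Subring (Matrix ι ι ℤ)) (hρS : ∀ a, ρ a ∈ S)
    (hSC : ∀ s ∈ S, ∀ a, ρ a * s = s * ρ a) (hSsat : ∀ (m : ℤ), m ≠ 0 → ∀ w, m • w ∈ S → w ∈ S)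
    {𝔞 : Ideal (NumberField.RingOfIntegers K)} (h𝔞0 : 𝔞 ≠ ⊥) (h𝔞1 : 𝔞 ≠ ⊤)
    (hscal : ∀ u ∈ S, ∃ a, ∀ t ∈ idealTorsion Φ ρ 𝔞, mapMatrix Φ Φ (u - ρ a) t = 0)
    {u : Matrix ι ι ℤ} (hu : u ∈ S) : ∃ x : NumberField.RingOfIntegers K, u = ρ x := by
  classical
  -- `𝔞 ∋ N(𝔞) ≠ 0`
  have hn : Ideal.absNorm 𝔞 ≠ 0 := fun h ↦ h𝔞0 (Ideal.absNorm_eq_zero_iff.1 h)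
  have h𝔞n : 𝔞 ∣ Ideal.span {((Ideal.absNorm 𝔞 : ℕ) : NumberField.RingOfIntegers K)} :=
    Ideal.dvd_iff_le.2 ((Ideal.span_singleton_le_iff_mem _).2 (Ideal.absNorm_mem 𝔞))
  obtain ⟨r, hr1, hr⟩ := exists_sub_one_mem_and_forall_mul_eq_map Φ ρ S hρS hSC hSsat hn h𝔞n hscal
  have hr0 : r ≠ 0 := by
    rintro rfl
    refine h𝔞1 (Ideal.eq_top_of_isUnit_mem _ hr1 ?_)
    rw [zero_sub]; exact isUnit_one.neg
  obtain ⟨b, hb⟩ := hr u hu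
  -- Cayley–Hamilton through `ρ`: `(scaleRoots χ_u r)(b) = ρ⁻¹(ρ(r)^d χ_u(u)) = 0`
  set p : Polynomial (NumberField.RingOfIntegers K) :=
    u.charpoly.map (Int.castRingHom (NumberField.RingOfIntegers K)) with hp
  have hpmonic : p.Monic := (Matrix.charpoly_monic u).map _
  have hpu : Polynomial.eval₂ ρ u p = 0 := by
    rw [hp, Polynomial.eval₂_map,
      Subsingleton.elim (ρ.comp (Int.castRingHom _)) (algebraMap ℤ (Matrix ι ι ℤ)), ← Polynomial.aeval_def,
      Matrix.aeval_self_charpoly]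
  have heval : Polynomial.eval b (p.scaleRoots r) = 0 := by
    apply hρ
    rw [map_zero, ← Polynomial.eval₂_hom, ← hb,
      Polynomial.scaleRoots_eval₂_mul_of_commute ρ u r (hSC u hu r) (fun s₁ s₂ ↦ ?_), hpu, mul_zero]
    rw [Commute, SemiconjBy, ← map_mul, mul_comm, map_mul]
  -- hence `b/r ∈ K` is integral over `ℤ`
  have hrK : (r : K) ≠ 0 := by exact_mod_cast hr0
  have hint : IsIntegral ℤ ((b : K) / r) := by
    refine ⟨u.charpoly, Matrix.charpoly_monic u, ?_⟩
    have h1 : Polynomial.eval₂ (algebraMap (NumberField.RingOfIntegers K) K) ((r : K) * ((b : K) / r))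
        (p.scaleRoots r) = 0 := by
      rw [mul_div_cancel₀ _ hrK, show (b : K) = algebraMap _ K b from rfl, Polynomial.eval₂_hom, heval,
        map_zero]
    rw [show (r : K) = algebraMap _ K r from rfl, Polynomial.scaleRoots_eval₂_mul, mul_eq_zero] at h1
    rcases h1 with h1 | h1
    · exact absurd (pow_eq_zero_iff'.1 h1).1 hrK
    · rwa [hp, Polynomial.eval₂_map,
        Subsingleton.elim ((algebraMap (NumberField.RingOfIntegers K) K).comp (Int.castRingHom _))
          (algebraMap ℤ K)] at h1
  -- so `b = r x` with `x ∈ 𝒪`, and `ρ(r)(u - ρ x) = 0`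
  let x : NumberField.RingOfIntegers K := ⟨(b : K) / r, (mem_integralClosure_iff ℤ K).2 hint⟩
  have hbx : b = r * x := by
    apply NumberField.RingOfIntegers.ext
    change (b : K) = (r : K) * ((b : K) / r)
    rw [mul_div_cancel₀ _ hrK]
  refine ⟨x, ?_⟩
  have h0 : ρ r * (u - ρ x) = 0 := by rw [mul_sub, hb, hbx, map_mul, sub_self]
  exact sub_eq_zero.1 (eq_zero_of_map_ringOfIntegers_mul_eq_zero ρ hr0 h0)

/-! ### §4 The subrings `End(X,i) = End(X) ∩ C(ρ𝒪)` and `End(X,i)^G` satisfy the hypotheses -/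

/-- `ρ(𝒪) ⊆ End(X,i)` when the action is holomorphic. [cite: Zarhin2009EndomorphismsSuperellipticJacobians, §3 (arXiv p0007: "`i(𝒪) ⊂ End_K(X,i) ⊂ End(X,i) ⊂ End(X)`")] -/
theorem map_mem_endRingInt_inf_centralizer (hρE : ∀ a, ρ a ∈ endRingInt Φ) (a : R) :
    ρ a ∈ endRingInt Φ ⊓ Subring.centralizer (Set.range ρ) := by
  refine Subring.mem_inf.2 ⟨hρE a, Subring.mem_centralizer_iff.2 ?_⟩
  rintro _ ⟨b, rfl⟩
  rw [← map_mul, mul_comm, map_mul]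

/-- Elements of `End(X,i)` commute with `ρ(𝒪)` (definition of the centralizer).
[cite: Zarhin2009EndomorphismsSuperellipticJacobians, §3 (arXiv p0007: "We write `End(X,i)` for the centralizer of `i(𝒪)` in `End(X)`")] -/
theorem map_mul_eq_mul_map_of_mem_centralizer {S₀ : Subring (Matrix ι ι ℤ)} {s : Matrix ι ι ℤ}
    (hs : s ∈ S₀ ⊓ Subring.centralizer (Set.range ρ)) (a : R) : ρ a * s = s * ρ a :=
  Subring.mem_centralizer_iff.1 (Subring.mem_inf.1 hs).2 _ ⟨a, rfl⟩

/-- **`End(X,i)` is saturated in `M_ι(ℤ)`** ("`End(X,i)` is a pure subgroup in `End(X)`", and `End(X)` is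
saturated in `M_ι(ℤ)` — the tree's `mem_endRingInt_of_smul_mem`). [cite: Zarhin2009EndomorphismsSuperellipticJacobians, §3 (arXiv p0007: "Obviously, `End(X,i)` is a pure subgroup in `End(X)`")] -/
theorem mem_endRingInt_inf_centralizer_of_smul_mem {m : ℤ} (hm : m ≠ 0) {w : Matrix ι ι ℤ}
    (hw : m • w ∈ endRingInt Φ ⊓ Subring.centralizer (Set.range ρ)) :
    w ∈ endRingInt Φ ⊓ Subring.centralizer (Set.range ρ) := by
  obtain ⟨hwE, hwC⟩ := Subring.mem_inf.1 hw
  refine Subring.mem_inf.2 ⟨mem_endRingInt_of_smul_mem Φ hm hwE, Subring.mem_centralizer_iff.2 fun g hg ↦ ?_⟩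
  have h := Subring.mem_centralizer_iff.1 hwC g hg
  rw [mul_smul_comm, smul_mul_assoc] at h
  ext i j
  have hij := congrFun (congrFun h i) j
  simp only [Matrix.smul_apply, smul_eq_mul] at hij
  exact mul_left_cancel₀ hm hij

/-- **The invariants `S^G = End_K(X,i)`** of a subring `S ∋ ρ(𝒪)` under any family of ring endomorphisms
fixing `ρ(𝒪)` ("`End_K(X,i) = {u ∈ End(X,i) ∣ ^σu = u ∀ σ ∈ Gal(K)}`") again contain `ρ(𝒪)`, and are
saturated when `S` is. [cite: Zarhin2009EndomorphismsSuperellipticJacobians, §3 (arXiv p0007)]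
[cite: Zarhin2018SuperellipticJacobians, §2.3 (arXiv p0005: "`End_K(X) = End(X)^{Gal(K)}`")] -/
theorem map_mem_inf_eqLocus_and_saturated {G : Type*} (σ : G → (Matrix ι ι ℤ →+* Matrix ι ι ℤ)) (hσ : ∀ g a, σ g (ρ a) = ρ a)
    (S : Subring (Matrix ι ι ℤ)) (hρS : ∀ a, ρ a ∈ S)
    (hSsat : ∀ (m : ℤ), m ≠ 0 → ∀ w, m • w ∈ S → w ∈ S) :
    (∀ a, ρ a ∈ S ⊓ ⨅ g, (σ g).eqLocus (RingHom.id _)) ∧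
      ∀ (m : ℤ), m ≠ 0 → ∀ w, m • w ∈ S ⊓ ⨅ g, (σ g).eqLocus (RingHom.id _) →
        w ∈ S ⊓ ⨅ g, (σ g).eqLocus (RingHom.id _) := by
  refine ⟨fun a ↦ Subring.mem_inf.2 ⟨hρS a, Subring.mem_iInf.2 fun g ↦ hσ g a⟩, fun m hm w hw ↦ ?_⟩
  obtain ⟨hwS, hwG⟩ := Subring.mem_inf.1 hw
  refine Subring.mem_inf.2 ⟨hSsat m hm w hwS, Subring.mem_iInf.2 fun g ↦ ?_⟩
  have h : σ g (m • w) = m • w := Subring.mem_iInf.1 hwG g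
  rw [map_zsmul] at h
  ext i j
  have hij := congrFun (congrFun h i) j
  simp only [Matrix.smul_apply, smul_eq_mul] at hij
  exact mul_left_cancel₀ hm hij

/-- **Zarhin 2009 (3) for `End(X,i)` itself**: for a holomorphic action `ρ` of a Dedekind domain `𝒪` on
`X`, an ideal `𝔞 ∋ n ≥ 1`, and `u ∈ End(X,i) = End(X) ∩ C(ρ𝒪)`: `u` kills `X_𝔞` iff `u ∈ 𝔞·End(X,i)` —
"`End(X,i) ⊗_𝒪 𝒪/𝔞 ↪ End_{𝒪/𝔞} X_𝔞`". [cite: Zarhin2009EndomorphismsSuperellipticJacobians, §3 (3) (arXiv p0008)]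
[cite: Zarhin2018SuperellipticJacobians, §3.6 (arXiv p0007)] -/
theorem forall_idealTorsion_mapMatrix_eq_zero_iff_endRingInt [IsDedekindDomain R]
    (hρE : ∀ a, ρ a ∈ endRingInt Φ) {𝔞 : Ideal R} {n : ℕ} (hn : n ≠ 0) (hn𝔞 : (n : R) ∈ 𝔞)
    {u : Matrix ι ι ℤ} (hu : u ∈ endRingInt Φ ⊓ Subring.centralizer (Set.range ρ)) :
    (∀ t ∈ idealTorsion Φ ρ 𝔞, mapMatrix Φ Φ u t = 0) ↔
      u ∈ AddSubgroup.closure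
        {v | ∃ a ∈ 𝔞, ∃ s ∈ endRingInt Φ ⊓ Subring.centralizer (Set.range ρ), ρ a * s = v} :=
  forall_idealTorsion_mapMatrix_eq_zero_iff_of_natCast_mem Φ ρ _ (map_mem_endRingInt_inf_centralizer Φ ρ hρE)
    (fun _ hs a ↦ map_mul_eq_mul_map_of_mem_centralizer ρ hs a)
    (fun _ hm _ hw ↦ mem_endRingInt_inf_centralizer_of_smul_mem Φ ρ hm hw) hn hn𝔞 hu

/-- **Zarhin 2009 Lemma 3.8 for `End_K(X,i) = End(X,i)^G`**: for the maximal order `𝒪 = 𝒪_K` acting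
faithfully and holomorphically, any family `σ` of ring endomorphisms of `M_ι(ℤ)` fixing `ρ(𝒪)` (the print's
Galois action `u ↦ ^σu` on `End(X)`), and a nonzero proper ideal `𝔞` (in print: maximal `λ`): if every
`σ`-invariant element of `End(X,i)` acts on `X_𝔞` as a scalar from `𝒪` — the printed consequence of
"`End_{G̃_{λ,X,K}}(X_λ) = k(λ)`" — then `End(X,i)^σ = ρ(𝒪)` ("then `End_K(X,i) = 𝒪`").
[cite: Zarhin2009EndomorphismsSuperellipticJacobians, §3 Lemma 3.8 (arXiv p0008)]
[cite: Zarhin2018SuperellipticJacobians, §3.7 Lemma 3.12 (arXiv p0008)] -/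
theorem exists_eq_map_of_forall_idealTorsion_invariants {K : Type*} [Field K] [NumberField K]
    (ρ : NumberField.RingOfIntegers K →+* Matrix ι ι ℤ) (hρ : Injective ρ) (hρE : ∀ a, ρ a ∈ endRingInt Φ)
    {G : Type*} (σ : G → (Matrix ι ι ℤ →+* Matrix ι ι ℤ)) (hσ : ∀ g a, σ g (ρ a) = ρ a)
    {𝔞 : Ideal (NumberField.RingOfIntegers K)} (h𝔞0 : 𝔞 ≠ ⊥) (h𝔞1 : 𝔞 ≠ ⊤)
    (hscal : ∀ u ∈ (endRingInt Φ ⊓ Subring.centralizer (Set.range ρ)) ⊓ ⨅ g, (σ g).eqLocus (RingHom.id _),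
      ∃ a, ∀ t ∈ idealTorsion Φ ρ 𝔞, mapMatrix Φ Φ (u - ρ a) t = 0)
    {u : Matrix ι ι ℤ}
    (hu : u ∈ (endRingInt Φ ⊓ Subring.centralizer (Set.range ρ)) ⊓ ⨅ g, (σ g).eqLocus (RingHom.id _)) :
    ∃ x : NumberField.RingOfIntegers K, u = ρ x := by
  obtain ⟨h1, h3⟩ := map_mem_inf_eqLocus_and_saturated ρ σ hσ (endRingInt Φ ⊓ Subring.centralizer (Set.range ρ))
    (map_mem_endRingInt_inf_centralizer Φ ρ hρE)
    (fun _ hm _ hw ↦ mem_endRingInt_inf_centralizer_of_smul_mem Φ ρ hm hw)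
  exact exists_eq_map_of_forall_idealTorsion Φ ρ hρ _ h1
    (fun s hs a ↦ map_mul_eq_mul_map_of_mem_centralizer ρ (Subring.mem_inf.1 hs).1 a) h3 h𝔞0 h𝔞1 hscal hu

end Literature.Geometry.Kaehler.ComplexTorus
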